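import Summits.ABC.IUTFork.Conditional.WRowBrobergUnconditionalSeven
import Summits.ABC.IUTFork.Conditional.WRowBrobergUnconditionalEleven
import Summits.ABC.IUTFork.Conditional.AbcOfSGenuineKLicence
import Summits.ABC.IUTFork.Cor312ThetaSideClosedK
import Summits.ABC.IUTFork.Cor312SettingDHVolWitness
import Summits.ABC.IUTFork.Cor312ProvKIdeles
import HarnessLib

/-!
# Branch C — the NUMBER-LEVEL typed [IUTchIII] Cor. 3.12 in READING (U) (`T.Cor312Of`) TRUE, NO hypothesis, at EVERY genuine Θ-volume datum over
# the quadratic BROBERG point `λ = (8−3√7)²(5−2√7)/(4−3√7)⁴` over `ℚ(√7)` at `l = 7` and `l = 11` — the R-W table's two (formerly last-open) non-rational rows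

C scoreboard (abc-iut-C-cert-3 gen 4, INTAKE / CERTS pen). PROOF-ONLY junction file (no `def`, no new `Prop`, no instance, no notation; nothing
re-typed); the number-field sequel of `AbcOfSCor312OfFrey283` (p484566) / `…AllLevels` (p489045) / `…HexBands` (p498110), same recipe, same words.
Inputs BY NAME: abc-iut-W-row-2 g3's `WRow.licence_broberg_seven_unconditional` (p496949) / `WRow.licence_broberg_eleven_unconditional` (p497044) over
the carrier `Broberg.point : NFPoint` (`BrobergPoint` p495875, `BrobergSqrt7` p495276; FINDINGS §T.4 «W:BROBERG-Q7-DECIDED»); abc-iut-C-cert-3's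
`GenuineK.cor312Of_of_licence` (p435505); abc-iut-s2-p6's `negLogTheta_settingPrVolSharp_pilotDataOfK_le_datum` (p447368); one-point context data
(abc-iut-c312-7's `unitSigDH/unitSplitDH/unitQDataDH/unitLatticeDH`, `M := ℚ`); realising ideles `Cor312Prov.exists_realising_{q,theta}Ideles_pilotDataOfK`
— all generic in the base point, so the rational recipe applies verbatim at a number-field point.

READING (numbers, no side): at the two Broberg rows the window certificates' number-binder instances (K and M, LINE-FREE) are THEOREMS; NO height bound
follows; cone binder `hregBad` untouched (C-R52); not a claim that abc is proved or refuted; no side on any author; inhabited-as-typed ≠ true-in-print;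
typed ≠ proved; instantiated ≠ endorsed. [cite: Mochizuki2012, IUTchIII Cor. 3.12 p. 173–174, Step (xi-f) p. 184; IUTchIV Thm. 1.10 p. 22–23, Cor. 2.2
(ii) proof (P5)(P7) p. 46; IUTchI Ex. 3.2 (iv) p. 71] [cite: DupuyHilado2025, §3.3, §3.4] [claim: Mochizuki2012, status: disputed]
-/

noncomputable section

open Set Function NumberField IsDedekindDomain

namespace Summit.ABC.IUTFork.Conditional

open Thm311 Thm311.Real Cor312 Cor312Vol Cor312Prov Literature.IUT.LogThetaLattice Literature.IUT.LogVolume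
  Literature.IUT.HodgeTheaters Literature.IUT.LogVolume.ThetaData Literature.IUT.LogVolume.Cor22
open Literature.NumberTheory.NumberFields Literature.NumberTheory.GaloisRepresentations.Ultrametric
open Literature.NumberTheory.DiophantineGeometry Literature.NumberTheory.DiophantineGeometry.GenEll Summit.ABC.ABC.Theorems

/-- **`T.Cor312Of` at EVERY genuine Θ-volume datum over the quadratic BROBERG point `λ = (8−3√7)²(5−2√7)/(4−3√7)⁴ ∈ ℚ(√7)` at `l = 7`, NO
hypothesis** — abc-iut-W-row-2 g3's unconditional licence `WRow.licence_broberg_seven_unconditional` (FINDINGS §T.4) at one-point context data and the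
realising ideles of [IUTchI] Ex. 3.2 (iv), through `GenuineK.cor312Of_of_licence` (p435505) + the Θ-descent p447368 — the first number-level (U) instance
at a NUMBER-FIELD (non-rational) datum carrier. [cite: Mochizuki2012, IUTchIII Cor. 3.12 p. 173–174; IUTchIV Cor. 2.2 (ii) proof (P5) p. 46]
[claim: Mochizuki2012, status: disputed] -/
theorem Broberg.cor312Of_seven (T : Cor22.ThetaVolumeDatumAt Broberg.point 7) : T.Cor312Of := by
  letI := T.instFieldF; letI := T.instNumberFieldF; letI := T.instAlgebraF; letI := T.instFieldK
  letI := T.instNumberFieldK; letI := T.instAlgebraK; letI := T.instFieldFbar; letI := T.instAlgebraFbar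
  letI := T.instAlgebraKFbar; letI := T.instIsElliptic
  obtain ⟨tq, htq0, htq1, htq⟩ := exists_realising_qIdeles_pilotDataOfK T.D
  obtain ⟨t, ht0, ht1, ht⟩ := exists_realising_thetaIdeles_pilotDataOfK T.D
  exact GenuineK.cor312Of_of_licence T.D T.K ℚ (fun _ _ => ∅) (fun _ _ => ∅) (fun _ _ _ => ∅) (fun _ _ _ => 0) (fun _ _ => ∅)
    (fun _ _ _ _ => ∅) 0 unitLatticeDH (unitSigDH (pilotDataOfK T.D T.K)) (unitSplitDH (pilotDataOfK T.D T.K))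
    (unitQDataDH (pilotDataOfK T.D T.K)) t tq T.isVolumeInputOf htq0 htq1 ht0 ht1 htq
    (WRow.licence_broberg_seven_unconditional T (logvAnalytic_analyticLogv (F := T.K)) ℚ (fun _ _ => ∅) (fun _ _ => ∅) (fun _ _ _ => ∅)
      (fun _ _ _ => 0) (fun _ _ => ∅) (fun _ _ _ _ => ∅) 0 unitLatticeDH (unitSigDH (pilotDataOfK T.D T.K)) (unitSplitDH (pilotDataOfK T.D T.K))
      (unitQDataDH (pilotDataOfK T.D T.K)) tq t htq0 htq1 ht0 ht htq)
    (negLogTheta_settingPrVolSharp_pilotDataOfK_le_datum T ℚ (fun _ _ => ∅) (fun _ _ => ∅) (fun _ _ _ => ∅) (fun _ _ _ => 0) (fun _ _ => ∅)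
      (fun _ _ _ _ => ∅) 0 unitLatticeDH (unitSigDH (pilotDataOfK T.D T.K)) (unitSplitDH (pilotDataOfK T.D T.K)) (unitQDataDH (pilotDataOfK T.D T.K))
      tq t htq0 htq1 ht0 ht)

/-- **`T.Cor312Of` at EVERY genuine Θ-volume datum over the quadratic BROBERG point `λ = (8−3√7)²(5−2√7)/(4−3√7)⁴ ∈ ℚ(√7)` at `l = 11`, NO
hypothesis** — abc-iut-W-row-2 g3's unconditional licence `WRow.licence_broberg_eleven_unconditional` (FINDINGS §T.4) at one-point context data and the
realising ideles of [IUTchI] Ex. 3.2 (iv), through `GenuineK.cor312Of_of_licence` (p435505) + the Θ-descent p447368 — the first number-level (U) instance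
at a NUMBER-FIELD (non-rational) datum carrier. [cite: Mochizuki2012, IUTchIII Cor. 3.12 p. 173–174; IUTchIV Cor. 2.2 (ii) proof (P5) p. 46]
[claim: Mochizuki2012, status: disputed] -/
theorem Broberg.cor312Of_eleven (T : Cor22.ThetaVolumeDatumAt Broberg.point 11) : T.Cor312Of := by
  letI := T.instFieldF; letI := T.instNumberFieldF; letI := T.instAlgebraF; letI := T.instFieldK
  letI := T.instNumberFieldK; letI := T.instAlgebraK; letI := T.instFieldFbar; letI := T.instAlgebraFbar
  letI := T.instAlgebraKFbar; letI := T.instIsElliptic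
  obtain ⟨tq, htq0, htq1, htq⟩ := exists_realising_qIdeles_pilotDataOfK T.D
  obtain ⟨t, ht0, ht1, ht⟩ := exists_realising_thetaIdeles_pilotDataOfK T.D
  exact GenuineK.cor312Of_of_licence T.D T.K ℚ (fun _ _ => ∅) (fun _ _ => ∅) (fun _ _ _ => ∅) (fun _ _ _ => 0) (fun _ _ => ∅)
    (fun _ _ _ _ => ∅) 0 unitLatticeDH (unitSigDH (pilotDataOfK T.D T.K)) (unitSplitDH (pilotDataOfK T.D T.K))
    (unitQDataDH (pilotDataOfK T.D T.K)) t tq T.isVolumeInputOf htq0 htq1 ht0 ht1 htq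
    (WRow.licence_broberg_eleven_unconditional T (logvAnalytic_analyticLogv (F := T.K)) ℚ (fun _ _ => ∅) (fun _ _ => ∅) (fun _ _ _ => ∅)
      (fun _ _ _ => 0) (fun _ _ => ∅) (fun _ _ _ _ => ∅) 0 unitLatticeDH (unitSigDH (pilotDataOfK T.D T.K)) (unitSplitDH (pilotDataOfK T.D T.K))
      (unitQDataDH (pilotDataOfK T.D T.K)) tq t htq0 htq1 ht0 ht htq)
    (negLogTheta_settingPrVolSharp_pilotDataOfK_le_datum T ℚ (fun _ _ => ∅) (fun _ _ => ∅) (fun _ _ _ => ∅) (fun _ _ _ => 0) (fun _ _ => ∅)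
      (fun _ _ _ _ => ∅) 0 unitLatticeDH (unitSigDH (pilotDataOfK T.D T.K)) (unitSplitDH (pilotDataOfK T.D T.K)) (unitQDataDH (pilotDataOfK T.D T.K))
      tq t htq0 htq1 ht0 ht)

end Summit.ABC.IUTFork.Conditional

end
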